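import Mathlib
import Literature.NumberTheory.LFunctions.Zhang2022.RepairBedCoherence
import Literature.NumberTheory.LFunctions.Zhang2022.KnifeEdgeRoughOverhang
import HarnessLib

/-!
# Zhang (2022), rescue bed (D-0124 (3)) Tier S add-on LENX, MODEL side: the registered overhang pieces `v_A` (arch),
# `v_J` (jump at the wall) in the knife-edge kit's continued calculus — classes, masses, the kernel mode's cross
# values, and the uu-slot restoration threshold (bed node G2-04 / N3-C «LENX», addons v0.2.6 clause (2) u_K word)

Topic `Literature/NumberTheory/LFunctions/Zhang2022` (Landau–Siegel audit tree; verdict-neutral).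
Y. Zhang, *Discrete mean estimates and the Landau–Siegel zero*, arXiv:2211.02515v1 (2022) [Zhang2022LandauSiegel] —
**an unrefereed manuscript under adjudication; nothing here asserts or denies any of its claims, and nothing here is
a claim about Landau–Siegel zeros.**

The bed's LENX rows (spec bed3-addons, `RepairBedBlocks`: `archProfile θ x = (x−1)(θ−x)`, `jumpProfile θ x =
1_{(1,θ]}(x)(θ−x)`, blocks `profBlockB`) print, next to the genuine 2×2 block `𝕄`, its MODEL: the continued formula I
`Repair.MformTop θ` of the knife-edge kit (`KnifeEdgeOverhangRankOne`, `KnifeEdgeRoughOverhang`): `model_uu = 𝔅(u)`,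
`model_uv = M_θ(u,v) = π·conj(Φ_v)·L(u)` (rank-one tail coupling), `model_vv = Re 𝔅_θ(v)`. This file puts the two
registered overhang pieces into that kit and records the closed forms a row cites:

* `archProfile_eq_phiT` (`x ≥ 1`) and `profCoefS_archProfile_eq` / `profBlockB_archProfile_eq_phiT` — on `n ≥ ⌈P⌉`
  the arch block IS the block of the tree's `Repair.phiT θ`, so `v_A`'s model side is `KnifeEdge.MformTop_gStar_phiT`,
  `KnifeEdge.overhangMass_phiT`, `KnifeEdge.overhangPiece_phiT` verbatim; `overhangMass_archProfile = (θ−1)³/6`;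
* `jumpProfile_eq_indicator`, the companion derivative `jumpProfile'`, **`roughOverhangPiece_jumpProfile`** (the jump
  is in the ROUGH class of `KnifeEdgeRoughOverhang`, breakpoint set `{1}`), hence `KnifeEdge.rough_rankOneTailCoupling`
  applies to it; `overhangMass_jumpProfile = (θ−1)²/2`;
* the kernel mode's cross values (`L(g⋆) = 24`, `KnifeEdge.tailFunctional_gStar`): `MformTop_gStar_archProfile_model`
  (`π·conj(Φ_A)·24 = 4π(θ−1)³`) and `MformTop_gStar_jumpProfile` (`M_θ(g⋆, v_J) = 12π(θ−1)²`, `M_θ(v_J, g⋆) = 0`);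
* the uu-slot restoration threshold `uKThreshold c b = ‖c‖²/b` (bed-3's `m_K*(v,θ)` with `c = model_uv(u_K,v,θ)`,
  `b = Re 𝔅_θ(v)`) and `blockQuad_nonneg_iff_threshold` (`μ ≥ 0`, `b > 0`: `[[μ,c],[c̄,b]]` PSD ⇔ `uKThreshold c b ≤ μ`
  — the registered word «PSD restored by the uu slot ALONE» as one lemma on `RepairBedCoherence.blockQuad_nonneg_iff`),
  with the two instances `uKThreshold_arch` / `uKThreshold_jump` (`16π²(θ−1)⁶/b`, `144π²(θ−1)⁴/b`).

`Re 𝔅_θ(v)` itself stays the engines' integral (no closed form in the tree; `Repair.MformTop_wit` keeps `M_θ(φ_θ,φ_θ)`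
symbolic). Caveat as in the kit: `M_θ`, `θ > 1`, is formula I's calculus continued, not a proved main term; nothing
here evaluates a genuine block or touches a registered word. No `instance`, no notation.

## References

* Y. Zhang, arXiv:2211.02515v1 (2022), §2 (2.23), (2.30); §7 Prop 7.1, (7.2) p.44; §8 (8.11)–(8.12).
  [cite: Zhang2022LandauSiegel, §§2, 7, 8]
-/

noncomputable section

open Complex Real ComplexConjugate Set intervalIntegral
open _root_.MeasureTheory

namespace Literature.NumberTheory.LFunctions.Zhang2022.Repair.Bed

open KnifeEdge

section Arch

variable {θ : ℝ}

/-- On `x ≥ 1` the arch profile is the tree's bump `φ_θ`: `archProfile θ x = Repair.phiT θ x`.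
[cite: Zhang2022LandauSiegel, §7 (7.2) p.44] -/
theorem archProfile_eq_phiT {x : ℝ} (hx : 1 ≤ x) : archProfile θ x = phiT θ x := by
  rw [archProfile, phiT_of_ge hx]

/-- Profile coefficients of the arch and of `φ_θ` agree at every `n ≥ P` (`P > 1`): there `log n/log P ≥ 1`.
[cite: Zhang2022LandauSiegel, §2 (2.23); §7 (7.2) p.44] -/
theorem profCoefS_archProfile_eq (S : Scale) (hP : 1 < S.P) {n : ℕ} (hn : S.P ≤ n) :
    profCoefS S (archProfile θ) n = profCoefS S (phiT θ) n := by
  have hlogP : 0 < Real.log S.P := Real.log_pos hP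
  have h1 : 1 ≤ Real.log n / Real.log S.P := by
    rw [le_div_iff₀ hlogP, one_mul]
    exact Real.log_le_log (by linarith) hn
  exact archProfile_eq_phiT h1

/-- Hence on a block `M ≤ n < N` with `P ≤ M` the arch block IS the `φ_θ` block: `v_A`'s model side is the tree's
`φ_θ` (`KnifeEdge.overhangPiece_phiT`, `overhangMass_phiT`, `MformTop_gStar_phiT`).
[cite: Zhang2022LandauSiegel, §2 (2.23), (2.30); §7 (7.2) p.44] -/
theorem profBlockB_archProfile_eq_phiT (S : Scale) (hP : 1 < S.P) {D : ℕ} (χ : DirichletCharacter ℂ D) {p : ℕ}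
    (ψ : DirichletCharacter ℂ p) {M : ℕ} (hM : S.P ≤ M) (N : ℕ) (s : ℂ) :
    profBlockB S χ ψ (archProfile θ) M N s = profBlockB S χ ψ (phiT θ) M N s := by
  unfold profBlockB coefBlockB
  refine Finset.sum_congr rfl fun n hn => ?_
  rw [profCoefS_archProfile_eq S hP (hM.trans (by exact_mod_cast (Finset.mem_Ico.1 hn).1))]

/-- Overhang mass of the arch: `Φ_A = ∫₁^θ (t−1)(θ−t) dt = (θ−1)³/6 = Repair.phiInt θ` (`θ ≥ 1`).
[cite: Zhang2022LandauSiegel, §7 (7.2) p.44] -/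
theorem overhangMass_archProfile (hθ : 1 ≤ θ) : overhangMass θ (archProfile θ) = ((phiInt θ : ℝ) : ℂ) := by
  rw [← overhangMass_phiT hθ]
  unfold overhangMass
  refine intervalIntegral.integral_congr fun t ht => ?_
  rw [uIcc_of_le hθ] at ht
  exact archProfile_eq_phiT ht.1

/-- The kernel mode's cross MODEL value against the arch: `π·conj(Φ_A)·L(g⋆) = 24πΦ(θ) = 4π(θ−1)³` (the
`model_uv(u_K, v_A, θ)` column; equals `M_θ(g⋆, φ_θ)` by `KnifeEdge.MformTop_gStar_phiT`).
[cite: Zhang2022LandauSiegel, §7 (7.2) p.44; §8 (8.11)–(8.12)] -/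
theorem crossModel_gStar_archProfile (hθ : 1 ≤ θ) :
    (π : ℂ) * conj (overhangMass θ (archProfile θ)) * tailFunctional gStar = ((4 * π * (θ - 1) ^ 3 : ℝ) : ℂ) := by
  rw [overhangMass_archProfile hθ, tailFunctional_gStar, Complex.conj_ofReal, phiInt]
  push_cast
  ring

/-- … and it IS the continued-calculus cross term of the tree's witness pieces: `M_θ(g⋆, φ_θ) = 4π(θ−1)³`.
[cite: Zhang2022LandauSiegel, §7 (7.2) p.44; §8 (8.11)–(8.12)] -/
theorem MformTop_gStar_phiT_eq (hθ : 1 ≤ θ) :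
    MformTop θ gStar gStar' (phiT θ) (phiT' θ) = ((4 * π * (θ - 1) ^ 3 : ℝ) : ℂ) := by
  rw [(MformTop_gStar_phiT hθ).1, phiInt]
  push_cast
  ring

end Arch

section Jump

variable {θ : ℝ}

/-- The jump profile is the indicator of `(1, θ]` times `θ − x`. [cite: Zhang2022LandauSiegel, §7 (7.2) p.44] -/
theorem jumpProfile_eq_indicator (θ : ℝ) :
    jumpProfile θ = (Ioc 1 θ).indicator fun x => (((θ - x) : ℝ) : ℂ) := by
  funext x
  by_cases hx : x ∈ Ioc 1 θ
  · rw [indicator_of_mem hx, jumpProfile, if_pos (show 1 < x ∧ x ≤ θ from hx)]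
  · rw [indicator_of_notMem hx, jumpProfile, if_neg (show ¬(1 < x ∧ x ≤ θ) from hx)]

/-- `v_J = θ − x` on `(1, θ]`. [cite: Zhang2022LandauSiegel, §7 (7.2) p.44] -/
theorem jumpProfile_of_mem {x : ℝ} (hx : x ∈ Ioc 1 θ) : jumpProfile θ x = (((θ - x) : ℝ) : ℂ) := by
  rw [jumpProfile, if_pos (show 1 < x ∧ x ≤ θ from hx)]

/-- `v_J = 0` off `(1, θ]` (in particular on `(−∞, 1]`: no mass at or below `P`). [cite: Zhang2022LandauSiegel, §7 (7.2) p.44] -/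
theorem jumpProfile_of_not_mem {x : ℝ} (hx : x ∉ Ioc 1 θ) : jumpProfile θ x = 0 := by
  rw [jumpProfile, if_neg (show ¬(1 < x ∧ x ≤ θ) from hx)]

/-- The companion (right) derivative of the jump profile: `−1` on `(1, θ)`, `0` elsewhere (the wall `x = 1` is the
one breakpoint). [cite: Zhang2022LandauSiegel, §7 (7.2) p.44] -/
def jumpProfile' (θ : ℝ) (x : ℝ) : ℂ := if 1 < x ∧ x < θ then -1 else 0

/-- **The jump at the wall is a ROUGH overhang piece** (`KnifeEdge.RoughOverhangPiece`, breakpoint set `{1}`): so the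
rank-one tail coupling `KnifeEdge.rough_rankOneTailCoupling` gives its model cross terms `M_θ(u, v_J) = π·conj(Φ_J)·L(u)`,
`M_θ(v_J, u) = 0` for every in-class `u`. (It is NOT a smooth `OverhangPiece`: `v_J(1⁺) = θ − 1 ≠ 0`.)
[cite: Zhang2022LandauSiegel, §7 (7.2) p.44] -/
theorem roughOverhangPiece_jumpProfile (θ : ℝ) : RoughOverhangPiece θ (jumpProfile θ) (jumpProfile' θ) where
  memLp := by
    rw [jumpProfile_eq_indicator]
    refine MemLp.of_bound ((Complex.continuous_ofReal.comp (continuous_const.sub continuous_id)).aestronglyMeasurable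
      |>.indicator measurableSet_Ioc) |θ - 1| ?_
    filter_upwards [ae_restrict_mem measurableSet_Ioc] with t ht
    rw [indicator_of_mem ht, Complex.norm_real, Real.norm_eq_abs]
    exact abs_le_abs (by linarith [ht.1]) (by linarith [ht.1, ht.2])
  memLp' := by
    refine MemLp.of_bound (Measurable.ite (measurableSet_Ioi.inter measurableSet_Iio) measurable_const
      measurable_const).aestronglyMeasurable 1 (Filter.Eventually.of_forall fun t => ?_)
    unfold jumpProfile'
    split_ifs <;> simp
  pwDeriv := by
    refine ⟨{1}, fun x hx hx1 => ?_⟩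
    have hx1' : 1 < x := lt_of_le_of_ne hx.1 (fun h => hx1 (Finset.mem_singleton.2 h.symm))
    have hd : HasDerivWithinAt (fun t : ℝ => (((θ - t) : ℝ) : ℂ)) (-1) (Ioi x) x := by
      have h1 : HasDerivAt (fun t : ℝ => (((θ - t) : ℝ) : ℂ)) ((((0 - 1 : ℝ)) : ℂ)) x :=
        ((hasDerivAt_const x θ).sub (hasDerivAt_id x)).ofReal_comp
      have e : (((0 - 1 : ℝ)) : ℂ) = -1 := by push_cast; ring
      rw [e] at h1
      exact h1.hasDerivWithinAt
    rw [jumpProfile', if_pos ⟨hx1', hx.2⟩]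
    refine hd.congr_of_eventuallyEq ?_ (jumpProfile_of_mem ⟨hx1', hx.2.le⟩)
    have hmem : Iio θ ∈ nhdsWithin x (Ioi x) := mem_nhdsWithin_of_mem_nhds (Iio_mem_nhds hx.2)
    filter_upwards [hmem, self_mem_nhdsWithin] with t ht1 ht2
    exact jumpProfile_of_mem ⟨hx1'.trans ht2, ht1.le⟩
  vanish := fun y hy => jumpProfile_of_not_mem fun h => not_lt.2 h.1.le hy
  vanish' := fun y hy => by rw [jumpProfile', if_neg (fun h => not_lt.2 h.1.le hy)]

/-- Overhang mass of the jump: `Φ_J = ∫₁^θ (θ−t) dt = (θ−1)²/2` (`θ ≥ 1`). [cite: Zhang2022LandauSiegel, §7 (7.2) p.44] -/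
theorem overhangMass_jumpProfile (hθ : 1 ≤ θ) :
    overhangMass θ (jumpProfile θ) = ((((θ - 1) ^ 2 / 2 : ℝ)) : ℂ) := by
  unfold overhangMass
  rw [intervalIntegral.integral_congr_Ioo_of_le hθ (g := fun t => (((θ - t) : ℝ) : ℂ))
    (fun t ht => jumpProfile_of_mem ⟨ht.1, ht.2.le⟩), intervalIntegral.integral_ofReal,
    intervalIntegral.integral_sub intervalIntegrable_const intervalIntegral.intervalIntegrable_id,
    intervalIntegral.integral_const, integral_id, smul_eq_mul]
  push_cast
  ring

/-- The kernel mode's cross MODEL value against the jump: `π·conj(Φ_J)·L(g⋆) = 12π(θ−1)²` (the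
`model_uv(u_K, v_J, θ)` column). [cite: Zhang2022LandauSiegel, §7 (7.2) p.44; §8 (8.11)–(8.12)] -/
theorem crossModel_gStar_jumpProfile (hθ : 1 ≤ θ) :
    (π : ℂ) * conj (overhangMass θ (jumpProfile θ)) * tailFunctional gStar = ((12 * π * (θ - 1) ^ 2 : ℝ) : ℂ) := by
  rw [overhangMass_jumpProfile hθ, tailFunctional_gStar, Complex.conj_ofReal]
  push_cast
  ring

/-- **`M_θ(g⋆, v_J) = 12π(θ−1)²` and `M_θ(v_J, g⋆) = 0`** (rank-one tail coupling on the rough class).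
[cite: Zhang2022LandauSiegel, §7 (7.2) p.44; §8 (8.11)–(8.12)] -/
theorem MformTop_gStar_jumpProfile (hθ : 1 ≤ θ) :
    MformTop θ gStar gStar' (jumpProfile θ) (jumpProfile' θ) = ((12 * π * (θ - 1) ^ 2 : ℝ) : ℂ) ∧
      MformTop θ (jumpProfile θ) (jumpProfile' θ) gStar gStar' = 0 := by
  obtain ⟨h1, h2⟩ := rough_rankOneTailCoupling hθ inClassPiece_gStar (roughOverhangPiece_jumpProfile θ)
  exact ⟨h1.trans (crossModel_gStar_jumpProfile hθ), h2⟩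

/-- For every in-class `u` the jump's model cross term is `π·(θ−1)²/2·L(u)` and the reverse term vanishes.
[cite: Zhang2022LandauSiegel, §7 (7.2) p.44; §8 (8.11)–(8.12)] -/
theorem MformTop_inClass_jumpProfile (hθ : 1 ≤ θ) {u u' : ℝ → ℂ} (hu : InClassPiece u u') :
    MformTop θ u u' (jumpProfile θ) (jumpProfile' θ) = ((((θ - 1) ^ 2 / 2 * π : ℝ)) : ℂ) * tailFunctional u ∧
      MformTop θ (jumpProfile θ) (jumpProfile' θ) u u' = 0 := by
  obtain ⟨h1, h2⟩ := rough_rankOneTailCoupling hθ hu (roughOverhangPiece_jumpProfile θ)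
  refine ⟨?_, h2⟩
  rw [h1, overhangMass_jumpProfile hθ, Complex.conj_ofReal]
  push_cast
  ring

end Jump

section Threshold

/-- **The uu-slot restoration threshold** `uKThreshold c b = ‖c‖²/b`: the least nonnegative `μ` for which the block
`[[μ, c],[c̄, b]]` (`b > 0`) is positive semi-definite — bed-3's `m_K*(v,θ)` with `c = model_uv(u_K,v,θ)`,
`b = Re 𝔅_θ(v)` (junk `‖c‖²/0 = 0` for `b = 0`). [cite: Zhang2022LandauSiegel, §7 (7.2) p.44] -/
def uKThreshold (c : ℂ) (b : ℝ) : ℝ := ‖c‖ ^ 2 / b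

/-- **The registered u_K word as one lemma**: for `μ ≥ 0` and `b > 0`, `[[μ, c],[c̄, b]]` is PSD iff
`uKThreshold c b ≤ μ` («PSD restored by the uu slot ALONE» ⇔ `m_K ≥ m_K*`; `RepairBedCoherence.blockQuad_nonneg_iff`).
[cite: Zhang2022LandauSiegel, §7 (7.2) p.44] -/
theorem blockQuad_nonneg_iff_threshold {μ b : ℝ} {c : ℂ} (hμ : 0 ≤ μ) (hb : 0 < b) :
    (∀ x y, 0 ≤ blockQuad μ b c x y) ↔ uKThreshold c b ≤ μ := by
  rw [blockQuad_nonneg_iff hμ hb.le, uKThreshold, div_le_iff₀ hb]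

/-- Below the threshold the block is indefinite: `0 ≤ μ < uKThreshold c b` (`b > 0`) ⇒ `q(−c/μ', 1) < 0` at an
explicit point (`RepairBedCoherence.exists_blockQuad_neg` / the corner-zero witness for `μ = 0`).
[cite: Zhang2022LandauSiegel, §7 (7.2) p.44] -/
theorem exists_blockQuad_neg_of_lt_threshold {μ b : ℝ} {c : ℂ} (hμ : 0 ≤ μ) (hb : 0 < b)
    (h : μ < uKThreshold c b) : ∃ x y, blockQuad μ b c x y < 0 := by
  by_contra hne
  have hall : ∀ x y, 0 ≤ blockQuad μ b c x y := fun x y => not_lt.mp fun hlt => hne ⟨x, y, hlt⟩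
  exact absurd ((blockQuad_nonneg_iff_threshold hμ hb).1 hall) (not_le.2 h)

/-- Instance `v_A`: `m_K*(v_A, θ) = ‖4π(θ−1)³‖²/b = 16π²(θ−1)⁶/b` (`b = Re 𝔅_θ(φ_θ)`, the engines' integral).
[cite: Zhang2022LandauSiegel, §7 (7.2) p.44] -/
theorem uKThreshold_arch (θ b : ℝ) :
    uKThreshold (((4 * π * (θ - 1) ^ 3 : ℝ)) : ℂ) b = 16 * π ^ 2 * (θ - 1) ^ 6 / b := by
  rw [uKThreshold, Complex.norm_real, Real.norm_eq_abs, sq_abs]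
  ring

/-- Instance `v_J`: `m_K*(v_J, θ) = ‖12π(θ−1)²‖²/b = 144π²(θ−1)⁴/b` (`b = Re 𝔅_θ(v_J)`).
[cite: Zhang2022LandauSiegel, §7 (7.2) p.44] -/
theorem uKThreshold_jump (θ b : ℝ) :
    uKThreshold (((12 * π * (θ - 1) ^ 2 : ℝ)) : ℂ) b = 144 * π ^ 2 * (θ - 1) ^ 4 / b := by
  rw [uKThreshold, Complex.norm_real, Real.norm_eq_abs, sq_abs]
  ring

end Threshold

end Literature.NumberTheory.LFunctions.Zhang2022.Repair.Bed
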